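import Mathlib.MeasureTheory.Measure.Lebesgue.EqHaar
import Literature.MathematicalPhysics.QuantumFieldTheory.Balaban1983to89.T4ShellMeasure

/-!
# N21 (NE7c) · (M1) for a 1-HOMOGENEOUS block statistic by DILATION AVERAGING — `T4ShellMeasure`'s device (α) in the
# leftward∕hazard currency: constant `3(d+1)∕(1−ρ)`, `d` = block dimension; no variable count, no independence, no
# transversality, no slope constant, no defect

R134 seat pub-ymgap-dag-n21-d (g8), node N21 = NE7c (single-run shell-weight bound, NOT PRINTED in [Bałaban 1983–89],
NOT proved), lane K3⁷ `SpineGivenEndpointR13SepCoPH` (stmt-QuantumFields-20544, `--kind proof --supports … --as helper`).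
Part 16 of the comparison series; chain-independent (imports `T4ShellMeasure` + Mathlib's `EqHaar`).

WHAT THIS FILE IS.  Parts 7–15 read each tested variable along ITS OWN coordinate; for plaquette variables sharing
bonds (Bianchi: no bond direction moves one `|F_p|` alone) that costs a double-shell defect whose recursion the tree does
not close (parts 12, 15).  `T4ShellMeasure` §5's grounding (α)∕(β) — DILATION of the block's integration variables — is
the fibre along which EVERY 1-homogeneous statistic moves monotonically at once, so that every sub-level cut is
STAR-SHAPED and NO exit ever occurs.  This file types it as an averaging argument, for `ν = e^{−A(x)} dx` on `ℝ^ι`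
(`d = card ι` the block dimension) and a measurable statistic `U` with `U(λx) = λ·U(x)` (`λ > 0`):
* §1 the dilates of the shell: `λ • {a ≤ U < b} = {λa ≤ U < λb}` (homogeneity); change of variables
  `ν(S) ≤ λ^{−d} · ∫_{λ•S} e^{−A}` when `A(λx) ≤ A(x)` on `S` (RADIAL MONOTONICITY of the action on the shell only,
  `λ ∈ [1−τ, 1]`) — Mathlib `Measure.map_addHaar_smul`;
* §2 averaging over `λ ∈ [1−τ, 1]` (Tonelli): each point `y` with `U(y) < b` lies in `λ•S` for a set of `λ` of length
  `≤ U(y)(1∕a − 1∕b) ≤ (b−a)∕a`; hence `τ·ν(S) ≤ (1−τ)^{−d}·((b−a)∕a)·ν{(1−τ)a ≤ U < b}`;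
* §3 `τ = 1∕(d+1)`, `(1+1∕d)^d ≤ 3`: ★ `measure_shell_le_of_homogeneous`:
  `ν{θ(1−ρ) ≤ U < θ} ≤ 3(d+1)·ρ∕(1−ρ) · ν{U < θ}` and ★ `slotAntiConcentration_restrict_of_homogeneous`:
  `T4ShellMeasure.SlotAntiConcentration (ν|{U<θ}) U θ ρ (3(d+1)∕(1−ρ))` — ON THE CUT LAW, with NO count of tested
  variables (U may be the sup of any family of homogeneous readings, arbitrarily cross-dependent), NO transversality,
  NO slope constant; the only analytic input is radial monotonicity of `A` on the shell, the price is the block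
  dimension `d` (device (α)'s `(LM₂R_j)⁴`-type factor: polynomial in the block size, K-uniform on the live window,
  absorbed by ROW T's `…LevelLedgerLinearGrowth.shellWeightBound_of_levels_summable`).

READING FOR THE WALL (hedged; nothing claimed for Bałaban's measure).  The intended instance is the fibre of the slot's
pending fluctuation integral (all variables of the block dilated ⇒ every cube statistic inside the block is homogeneous
for the LINEARISED field strength; the true plaquette holonomy is homogeneous only to leading order — grounding (β) —
and statistics of cubes outside the block must not read the block's variables: both LOCATED, displayed nowhere as
theorems); radial monotonicity of the small-field action on the shell region is the one estimate-like input.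

HONEST FRAMING.  [textbook] measure theory (Haar scaling on `ℝ^d`, Tonelli); 0 def, 0 sorry; NE7c NOT PRINTED ∕ NOT
proved; N21 NOT discharged; counts unmoved (typed 28∕28 · discharged 5∕27); count-neutral; one finite 𝕋⁴ at fixed ε —
nothing about ℝ⁴ ∕ OS ∕ mass gap ∕ Clay.
-/

open MeasureTheory Set Function Module
open scoped ENNReal NNReal Pointwise

namespace Summit.QuantumFields.YangMills.Theorems.N21DilationHazard

open Literature.MathematicalPhysics.QuantumFieldTheory.Balaban1983to89.T4ShellMeasure (SlotAntiConcentration)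

variable {ι : Type*} [Fintype ι]

/-! ## §1 The dilates of the shell and the change of variables -/

omit [Fintype ι] in
/-- for a 1-homogeneous statistic, the `λ`-dilate of the shell `{a ≤ U < b}` is the shell `{λa ≤ U < λb}` (`λ > 0`).
[textbook] -/
theorem smul_shell_eq {U : (ι → ℝ) → ℝ} (hU : ∀ (c : ℝ), 0 < c → ∀ x, U (c • x) = c * U x)
    {l : ℝ} (hl : 0 < l) (a b : ℝ) :
    l • {x : ι → ℝ | a ≤ U x ∧ U x < b} = {y | l * a ≤ U y ∧ U y < l * b} := by
  ext y
  rw [Set.mem_smul_set_iff_inv_smul_mem₀ hl.ne']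
  simp only [mem_setOf_eq]
  rw [hU _ (inv_pos.2 hl)]
  constructor
  · rintro ⟨h1, h2⟩
    constructor
    · have := mul_le_mul_of_nonneg_left h1 hl.le
      rwa [← mul_assoc, mul_inv_cancel₀ hl.ne', one_mul] at this
    · have := mul_lt_mul_of_pos_left h2 hl
      rwa [← mul_assoc, mul_inv_cancel₀ hl.ne', one_mul] at this
  · rintro ⟨h1, h2⟩
    constructor
    · have := mul_le_mul_of_nonneg_left h1 (inv_pos.2 hl).le
      rwa [← mul_assoc, inv_mul_cancel₀ hl.ne', one_mul] at this
    · have := mul_lt_mul_of_pos_left h2 (inv_pos.2 hl)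
      rwa [← mul_assoc, inv_mul_cancel₀ hl.ne', one_mul] at this

/-- **CHANGE OF VARIABLES UNDER RADIAL MONOTONICITY.**  If `A(λx) ≤ A(x)` for `x ∈ S` (`0 < λ ≤ 1`… any `λ > 0`), then
`∫_S e^{−A} ≤ λ^{−d} · ∫_{λ•S} e^{−A}`, `d = card ι` (Mathlib `Measure.map_addHaar_smul`). [textbook] -/
theorem setLIntegral_le_pow_mul_setLIntegral_smul {A : (ι → ℝ) → ℝ} (hA : Measurable A) {S : Set (ι → ℝ)}
    (hS : MeasurableSet S) {l : ℝ} (hl : 0 < l) (hmono : ∀ x ∈ S, A (l • x) ≤ A x) :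
    ∫⁻ x in S, ENNReal.ofReal (Real.exp (-A x))
      ≤ ENNReal.ofReal ((l ^ Fintype.card ι)⁻¹) * ∫⁻ y in l • S, ENNReal.ofReal (Real.exp (-A y)) := by
  have hg : Measurable fun x : ι → ℝ => ENNReal.ofReal (Real.exp (-A x)) :=
    ENNReal.measurable_ofReal.comp (Real.measurable_exp.comp hA.neg)
  have hlS : MeasurableSet (l • S) := hS.const_smul₀ l
  -- step 1: monotonicity inside `S`
  have h1 : ∫⁻ x in S, ENNReal.ofReal (Real.exp (-A x))
      ≤ ∫⁻ x in S, ENNReal.ofReal (Real.exp (-A (l • x))) :=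
    setLIntegral_mono' hS fun x hx =>
      ENNReal.ofReal_le_ofReal (Real.exp_le_exp.2 (by linarith [hmono x hx]))
  refine h1.trans ?_
  -- step 2: `∫_S g(λx) dx = ∫ (𝟙_{λS}·g)(λx) dx = λ^{-d} ∫_{λS} g`
  have hind : ∀ x : ι → ℝ, S.indicator (fun x => ENNReal.ofReal (Real.exp (-A (l • x)))) x
      = (l • S).indicator (fun y => ENNReal.ofReal (Real.exp (-A y))) (l • x) := by
    intro x
    by_cases hx : x ∈ S
    · rw [indicator_of_mem hx, indicator_of_mem (Set.smul_mem_smul_set hx)]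
    · rw [indicator_of_notMem hx, indicator_of_notMem]
      rwa [Set.mem_smul_set_iff_inv_smul_mem₀ hl.ne', inv_smul_smul₀ hl.ne']
  rw [← lintegral_indicator hS, ← lintegral_indicator hlS]
  simp_rw [hind]
  rw [← lintegral_map ((hg.indicator hlS)) (measurable_const_smul l),
    Measure.map_addHaar_smul volume hl.ne', lintegral_smul_measure, finrank_fintype_fun_eq_card,
    abs_of_nonneg (inv_nonneg.2 (pow_nonneg hl.le _)), smul_eq_mul]

/-! ## §2 Averaging over the dilation parameter -/

/-- the set of dilation parameters `λ ∈ [1−τ, 1]` for which a point `y` with `U(y) < b` lies in the `λ`-dilate of the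
shell has length `≤ (b − a)∕a` (`0 < a ≤ b`); it is empty unless `(1−τ)a ≤ U(y)`. [textbook] -/
theorem volume_params_le {a b τ u : ℝ} (ha : 0 < a) (hab : a ≤ b) (hub : u < b) :
    volume {l : ℝ | l ∈ Icc (1 - τ) 1 ∧ (l * a ≤ u ∧ u < l * b)}
      ≤ ENNReal.ofReal ((b - a) / a) * {u' : ℝ | (1 - τ) * a ≤ u'}.indicator 1 u := by
  by_cases hu : (1 - τ) * a ≤ u
  · rw [indicator_of_mem (show u ∈ {u' : ℝ | (1 - τ) * a ≤ u'} from hu), Pi.one_apply, mul_one]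
    have hb : 0 < b := lt_of_lt_of_le ha hab
    have hsub : {l : ℝ | l ∈ Icc (1 - τ) 1 ∧ (l * a ≤ u ∧ u < l * b)} ⊆ Icc (u / b) (u / a) := by
      rintro l ⟨-, h1, h2⟩
      exact ⟨(div_le_iff₀ hb).2 (by linarith), (le_div_iff₀ ha).2 (by linarith)⟩
    refine (measure_mono hsub).trans ?_
    rw [Real.volume_Icc]
    refine ENNReal.ofReal_le_ofReal ?_
    rw [div_sub_div _ _ ha.ne' hb.ne', div_le_div_iff₀ (mul_pos ha hb) ha]
    have hu0 : u * b - u * a ≤ b * (b - a) := by nlinarith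
    nlinarith
  · have hempty : {l : ℝ | l ∈ Icc (1 - τ) 1 ∧ (l * a ≤ u ∧ u < l * b)} = ∅ := by
      ext l
      simp only [mem_setOf_eq, mem_Icc, mem_empty_iff_false, iff_false, not_and]
      intro hl h1 _
      exact hu ((mul_le_mul_of_nonneg_right hl.1 ha.le).trans h1)
    rw [hempty, measure_empty]
    exact bot_le

/-- **DILATION AVERAGING.**  `ν = e^{−A} dx` on `ℝ^ι`, `U` measurable and 1-homogeneous, `0 < a ≤ b`, `τ < 1`,
and `A(λx) ≤ A(x)` for `x` in the shell `{a ≤ U < b}` and `λ ∈ [1−τ, 1]` (radial monotonicity on the shell).  Then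
`τ · ν{a ≤ U < b} ≤ (1−τ)^{−d} · (b−a)∕a · ν{(1−τ)a ≤ U < b}`. [textbook] -/
theorem measure_shell_le_average {A : (ι → ℝ) → ℝ} (hA : Measurable A) {U : (ι → ℝ) → ℝ} (hUm : Measurable U)
    (hU : ∀ (c : ℝ), 0 < c → ∀ x, U (c • x) = c * U x) {a b τ : ℝ} (ha : 0 < a) (hab : a ≤ b) (hτ1 : τ < 1)
    (hmono : ∀ l ∈ Icc (1 - τ) 1, ∀ x, a ≤ U x → U x < b → A (l • x) ≤ A x) :
    ENNReal.ofReal τ * (volume.withDensity fun x => ENNReal.ofReal (Real.exp (-A x))) {x | a ≤ U x ∧ U x < b}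
      ≤ ENNReal.ofReal (((1 - τ) ^ Fintype.card ι)⁻¹ * ((b - a) / a))
        * (volume.withDensity fun x => ENNReal.ofReal (Real.exp (-A x))) {x | (1 - τ) * a ≤ U x ∧ U x < b} := by
  set g : (ι → ℝ) → ℝ≥0∞ := fun x => ENNReal.ofReal (Real.exp (-A x)) with hgdef
  have hg : Measurable g := ENNReal.measurable_ofReal.comp (Real.measurable_exp.comp hA.neg)
  set S : Set (ι → ℝ) := {x | a ≤ U x ∧ U x < b} with hSdef
  set P : Set (ι → ℝ) := {x | (1 - τ) * a ≤ U x ∧ U x < b} with hPdef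
  have hS : MeasurableSet S := (measurableSet_le measurable_const hUm).inter (measurableSet_lt hUm measurable_const)
  have hP : MeasurableSet P := (measurableSet_le measurable_const hUm).inter (measurableSet_lt hUm measurable_const)
  set d := Fintype.card ι with hd
  rw [withDensity_apply _ hS, withDensity_apply _ hP]
  -- (i) for every λ ∈ [1−τ, 1]: ν(S) ≤ (1−τ)^{-d} ∫ 𝟙[λa ≤ U < λb] g
  have hstep : ∀ l ∈ Icc (1 - τ) 1, ∫⁻ x in S, g x
      ≤ ENNReal.ofReal (((1 - τ) ^ d)⁻¹) * ∫⁻ y, {y | l * a ≤ U y ∧ U y < l * b}.indicator g y := by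
    intro l hl
    have hl0 : 0 < l := by linarith [hl.1]
    have h := setLIntegral_le_pow_mul_setLIntegral_smul hA hS hl0 (fun x hx => hmono l hl x hx.1 hx.2)
    rw [smul_shell_eq hU hl0] at h
    have hlS : MeasurableSet {y : ι → ℝ | l * a ≤ U y ∧ U y < l * b} :=
      (measurableSet_le measurable_const hUm).inter (measurableSet_lt hUm measurable_const)
    rw [← lintegral_indicator hlS] at h
    refine h.trans (mul_le_mul_left (ENNReal.ofReal_le_ofReal ?_) _)
    rw [inv_le_inv₀ (pow_pos hl0 _) (pow_pos (by linarith) _)]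
    exact pow_le_pow_left₀ (by linarith) hl.1 _
  -- (ii) integrate (i) over λ ∈ [1−τ, 1]
  have hI : ENNReal.ofReal τ * ∫⁻ x in S, g x
      = ∫⁻ _ in Icc (1 - τ) (1 : ℝ), ∫⁻ x in S, g x := by
    rw [setLIntegral_const, Real.volume_Icc, mul_comm]
    congr 2
    ring
  rw [hI]
  have hF : Measurable (Function.uncurry fun (l : ℝ) (y : ι → ℝ) =>
      {y | l * a ≤ U y ∧ U y < l * b}.indicator g y) := by
    have hset : MeasurableSet {q : ℝ × (ι → ℝ) | q.1 * a ≤ U q.2 ∧ U q.2 < q.1 * b} :=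
      (measurableSet_le (measurable_fst.mul_const a) (hUm.comp measurable_snd)).inter
        (measurableSet_lt (hUm.comp measurable_snd) (measurable_fst.mul_const b))
    have : (Function.uncurry fun (l : ℝ) (y : ι → ℝ) => {y | l * a ≤ U y ∧ U y < l * b}.indicator g y)
        = {q : ℝ × (ι → ℝ) | q.1 * a ≤ U q.2 ∧ U q.2 < q.1 * b}.indicator (g ∘ Prod.snd) := by
      funext q
      rcases q with ⟨l, y⟩
      by_cases hq : l * a ≤ U y ∧ U y < l * b
      · rw [Function.uncurry_apply_pair, indicator_of_mem (show y ∈ {y | l * a ≤ U y ∧ U y < l * b} from hq),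
          indicator_of_mem (show (l, y) ∈ {q : ℝ × (ι → ℝ) | q.1 * a ≤ U q.2 ∧ U q.2 < q.1 * b} from hq)]
        rfl
      · rw [Function.uncurry_apply_pair, indicator_of_notMem (show y ∉ {y | l * a ≤ U y ∧ U y < l * b} from hq),
          indicator_of_notMem (show (l, y) ∉ {q : ℝ × (ι → ℝ) | q.1 * a ≤ U q.2 ∧ U q.2 < q.1 * b} from hq)]
    rw [this]
    exact (hg.comp measurable_snd).indicator hset
  calc ∫⁻ l in Icc (1 - τ) (1 : ℝ), ∫⁻ x in S, g x
      ≤ ∫⁻ l in Icc (1 - τ) (1 : ℝ), ENNReal.ofReal (((1 - τ) ^ d)⁻¹)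
          * ∫⁻ y, {y | l * a ≤ U y ∧ U y < l * b}.indicator g y := setLIntegral_mono' measurableSet_Icc hstep
    _ = ENNReal.ofReal (((1 - τ) ^ d)⁻¹)
          * ∫⁻ l in Icc (1 - τ) (1 : ℝ), ∫⁻ y, {y | l * a ≤ U y ∧ U y < l * b}.indicator g y := by
        rw [lintegral_const_mul' _ _ ENNReal.ofReal_ne_top]
    _ = ENNReal.ofReal (((1 - τ) ^ d)⁻¹)
          * ∫⁻ y, ∫⁻ l in Icc (1 - τ) (1 : ℝ), {y | l * a ≤ U y ∧ U y < l * b}.indicator g y := by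
        rw [lintegral_lintegral_swap hF.aemeasurable]
    _ ≤ ENNReal.ofReal (((1 - τ) ^ d)⁻¹) * ∫⁻ y, ENNReal.ofReal ((b - a) / a) * P.indicator g y := by
        refine mul_le_mul_right (lintegral_mono fun y => ?_) _
        -- the inner integral is `g y ×` the length of the admissible parameters
        by_cases hyb : U y < b
        · have hind : ∀ l, {y | l * a ≤ U y ∧ U y < l * b}.indicator g y
              = {l : ℝ | l * a ≤ U y ∧ U y < l * b}.indicator (fun _ => g y) l := by
            intro l
            by_cases h : l * a ≤ U y ∧ U y < l * b
            · rw [indicator_of_mem (show y ∈ {y | l * a ≤ U y ∧ U y < l * b} from h),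
                indicator_of_mem (show l ∈ {l : ℝ | l * a ≤ U y ∧ U y < l * b} from h)]
            · rw [indicator_of_notMem (show y ∉ {y | l * a ≤ U y ∧ U y < l * b} from h),
                indicator_of_notMem (show l ∉ {l : ℝ | l * a ≤ U y ∧ U y < l * b} from h)]
          have hlset : MeasurableSet {l : ℝ | l * a ≤ U y ∧ U y < l * b} :=
            (measurableSet_le (measurable_id.mul_const a) measurable_const).inter
              (measurableSet_lt measurable_const (measurable_id.mul_const b))
          simp_rw [hind]
          rw [lintegral_indicator hlset, setLIntegral_const, Measure.restrict_apply hlset]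
          have hv := volume_params_le (τ := τ) ha hab hyb
          have hset_eq : {l : ℝ | l * a ≤ U y ∧ U y < l * b} ∩ Icc (1 - τ) 1
              = {l : ℝ | l ∈ Icc (1 - τ) 1 ∧ (l * a ≤ U y ∧ U y < l * b)} := by
            ext l; simp only [mem_inter_iff, mem_setOf_eq]; tauto
          rw [hset_eq, mul_comm]
          refine (mul_le_mul_left hv _).trans (le_of_eq ?_)
          by_cases hyP : (1 - τ) * a ≤ U y
          · rw [indicator_of_mem (show U y ∈ {u' : ℝ | (1 - τ) * a ≤ u'} from hyP),
              indicator_of_mem (show y ∈ P from ⟨hyP, hyb⟩), Pi.one_apply, mul_one]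
          · rw [indicator_of_notMem (show U y ∉ {u' : ℝ | (1 - τ) * a ≤ u'} from hyP),
              indicator_of_notMem (show y ∉ P from fun h => hyP h.1), mul_zero, zero_mul]
        · -- `U y ≥ b`: no parameter `λ ≤ 1` puts `y` in a dilate
          have hzero : ∀ l ∈ Icc (1 - τ) (1 : ℝ), {y | l * a ≤ U y ∧ U y < l * b}.indicator g y = 0 := by
            intro l hl
            refine indicator_of_notMem (fun h => hyb ?_) _
            have hb : 0 < b := lt_of_lt_of_le ha hab
            calc U y < l * b := h.2
              _ ≤ 1 * b := mul_le_mul_of_nonneg_right hl.2 hb.le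
              _ = b := one_mul b
          rw [setLIntegral_congr_fun measurableSet_Icc hzero, lintegral_zero]
          exact bot_le
    _ = ENNReal.ofReal (((1 - τ) ^ d)⁻¹ * ((b - a) / a)) * ∫⁻ y in P, g y := by
        rw [lintegral_const_mul _ (hg.indicator hP), lintegral_indicator hP, ← mul_assoc,
          ← ENNReal.ofReal_mul (inv_nonneg.2 (pow_nonneg (by linarith) _))]

/-! ## §3 The choice `τ = 1∕(d+1)` and the (M1) form on the cut law -/

/-- `(1 − 1∕(d+1))^{−d} = (1 + 1∕d)^d ≤ 3` (indeed `≤ e`). [textbook] -/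
theorem inv_pow_le_three (d : ℕ) : ((1 - 1 / ((d : ℝ) + 1)) ^ d)⁻¹ ≤ 3 := by
  have hd : (0 : ℝ) < d + 1 := by positivity
  have h1 : 1 - 1 / ((d : ℝ) + 1) = (d : ℝ) / (d + 1) := by
    field_simp
    ring
  rw [h1, ← inv_pow, inv_div]
  -- `((d+1)/d)^d ≤ e ≤ 3` via `(1 + 1/d)^d ≤ exp 1`
  rcases Nat.eq_zero_or_pos d with hd0 | hdpos
  · subst hd0; norm_num
  · have hdR : (0 : ℝ) < d := by exact_mod_cast hdpos
    have h2 : ((d : ℝ) + 1) / d = 1 + 1 / d := by field_simp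
    rw [h2]
    have h3 : (1 + 1 / (d : ℝ)) ^ d ≤ Real.exp 1 := by
      have h4 : (1 + 1 / (d : ℝ)) ≤ Real.exp (1 / d) := by
        have := Real.add_one_le_exp (1 / (d : ℝ))
        linarith
      calc (1 + 1 / (d : ℝ)) ^ d ≤ (Real.exp (1 / d)) ^ d :=
            pow_le_pow_left₀ (by positivity) h4 d
        _ = Real.exp 1 := by rw [← Real.exp_nat_mul]; congr 1; field_simp
    have h5 : Real.exp 1 ≤ 3 := by
      have := Real.exp_one_lt_d9
      linarith
    linarith

/-- **THE SHELL OF A HOMOGENEOUS STATISTIC IS A `3(d+1)ρ∕(1−ρ)`-FRACTION OF THE SUB-THRESHOLD MASS.**  `ν = e^{−A} dx`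
on `ℝ^ι`, `d = card ι ≥ 1`; `U` measurable and 1-homogeneous; `θ > 0`, `0 < ρ < 1`; RADIAL MONOTONICITY of the
action on the shell: `A(λx) ≤ A(x)` for `θ(1−ρ) ≤ U(x) < θ`, `λ ∈ [1 − 1∕(d+1), 1]`.  Then
`ν{θ(1−ρ) ≤ U < θ} ≤ 3(d+1)·ρ∕(1−ρ) · ν{U < θ}` — no count of tested variables, no transversality, no slope
constant. [textbook] -/
theorem measure_shell_le_of_homogeneous [Nonempty ι] {A : (ι → ℝ) → ℝ} (hA : Measurable A)
    {U : (ι → ℝ) → ℝ} (hUm : Measurable U) (hU : ∀ (c : ℝ), 0 < c → ∀ x, U (c • x) = c * U x)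
    {θ ρ : ℝ} (hθ : 0 < θ) (hρ0 : 0 < ρ) (hρ1 : ρ < 1)
    (hmono : ∀ l ∈ Icc (1 - 1 / ((Fintype.card ι : ℝ) + 1)) 1, ∀ x,
      θ * (1 - ρ) ≤ U x → U x < θ → A (l • x) ≤ A x) :
    (volume.withDensity fun x => ENNReal.ofReal (Real.exp (-A x))) {x | θ * (1 - ρ) ≤ U x ∧ U x < θ}
      ≤ ENNReal.ofReal (3 * ((Fintype.card ι : ℝ) + 1) * (ρ / (1 - ρ)))
        * (volume.withDensity fun x => ENNReal.ofReal (Real.exp (-A x))) {x | U x < θ} := by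
  set d := Fintype.card ι with hd
  set τ : ℝ := 1 / ((d : ℝ) + 1) with hτ
  have hd1 : (0 : ℝ) < d + 1 := by positivity
  have hdge : (1 : ℝ) ≤ d := by
    rw [hd]
    exact_mod_cast Fintype.card_pos
  have hτ0 : 0 < τ := by positivity
  have hτ1 : τ < 1 := by
    rw [hτ, div_lt_one hd1]
    linarith
  have ha : 0 < θ * (1 - ρ) := mul_pos hθ (by linarith)
  have hab : θ * (1 - ρ) ≤ θ := by nlinarith
  have h := measure_shell_le_average hA hUm hU ha hab hτ1 hmono
  -- divide by `τ` and bound the constants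
  have hτne : ENNReal.ofReal τ ≠ 0 := (ENNReal.ofReal_pos.2 hτ0).ne'
  have hτtop : ENNReal.ofReal τ ≠ ⊤ := ENNReal.ofReal_ne_top
  have hkey : (volume.withDensity fun x => ENNReal.ofReal (Real.exp (-A x))) {x | θ * (1 - ρ) ≤ U x ∧ U x < θ}
      ≤ (ENNReal.ofReal τ)⁻¹ * (ENNReal.ofReal (((1 - τ) ^ d)⁻¹ * ((θ - θ * (1 - ρ)) / (θ * (1 - ρ))))
        * (volume.withDensity fun x => ENNReal.ofReal (Real.exp (-A x)))
            {x | (1 - τ) * (θ * (1 - ρ)) ≤ U x ∧ U x < θ}) := by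
    rw [← ENNReal.mul_le_iff_le_inv hτne hτtop]
    exact h
  refine hkey.trans ?_
  rw [← mul_assoc, ← ENNReal.ofReal_inv_of_pos hτ0,
    ← ENNReal.ofReal_mul (inv_nonneg.2 hτ0.le)]
  refine mul_le_mul' (ENNReal.ofReal_le_ofReal ?_) (measure_mono fun x hx => hx.2)
  -- τ⁻¹ · (1−τ)^{-d} · ((θ − θ(1−ρ))/(θ(1−ρ))) ≤ 3(d+1) · ρ/(1−ρ)
  have hfrac : (θ - θ * (1 - ρ)) / (θ * (1 - ρ)) = ρ / (1 - ρ) := by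
    field_simp
    ring
  have hinv : τ⁻¹ = (d : ℝ) + 1 := by rw [hτ, one_div, inv_inv]
  rw [hfrac, hinv]
  have h3 := inv_pow_le_three d
  have hρ' : 0 ≤ ρ / (1 - ρ) := div_nonneg hρ0.le (by linarith)
  have hpow : 0 ≤ ((1 - τ) ^ d)⁻¹ := inv_nonneg.2 (pow_nonneg (by linarith) _)
  calc ((d : ℝ) + 1) * (((1 - τ) ^ d)⁻¹ * (ρ / (1 - ρ)))
      ≤ ((d : ℝ) + 1) * (3 * (ρ / (1 - ρ))) := by
        refine mul_le_mul_of_nonneg_left (mul_le_mul_of_nonneg_right ?_ hρ') hd1.le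
        rw [hτ]; exact h3
    _ = 3 * ((d : ℝ) + 1) * (ρ / (1 - ρ)) := by ring

/-- **(M1) ON THE CUT LAW FOR A 1-HOMOGENEOUS STATISTIC — device (α) typed.**  Under the hypotheses of
`measure_shell_le_of_homogeneous`: `T4ShellMeasure.SlotAntiConcentration (ν|{U < θ}) U θ ρ (3(d+1)∕(1−ρ))`.
[textbook] -/
theorem slotAntiConcentration_restrict_of_homogeneous [Nonempty ι] {A : (ι → ℝ) → ℝ} (hA : Measurable A)
    {U : (ι → ℝ) → ℝ} (hUm : Measurable U) (hU : ∀ (c : ℝ), 0 < c → ∀ x, U (c • x) = c * U x)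
    {θ ρ : ℝ} (hθ : 0 < θ) (hρ0 : 0 < ρ) (hρ1 : ρ < 1)
    (hmono : ∀ l ∈ Icc (1 - 1 / ((Fintype.card ι : ℝ) + 1)) 1, ∀ x,
      θ * (1 - ρ) ≤ U x → U x < θ → A (l • x) ≤ A x) :
    SlotAntiConcentration
      ((volume.withDensity fun x => ENNReal.ofReal (Real.exp (-A x))).restrict {x | U x < θ})
      U θ ρ (3 * ((Fintype.card ι : ℝ) + 1) / (1 - ρ)) := by
  unfold SlotAntiConcentration
  have hE : MeasurableSet {x : ι → ℝ | U x < θ} := measurableSet_lt hUm measurable_const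
  have hinter : {x : ι → ℝ | θ * (1 - ρ) ≤ U x ∧ U x < θ} ∩ {x | U x < θ}
      = {x | θ * (1 - ρ) ≤ U x ∧ U x < θ} := inter_eq_left.2 fun x hx => hx.2
  rw [Measure.restrict_apply_univ, Measure.restrict_apply' hE, hinter]
  have h := measure_shell_le_of_homogeneous hA hUm hU hθ hρ0 hρ1 hmono
  refine h.trans (le_of_eq ?_)
  congr 2
  field_simp

/-! ## §4 The slot-ledger field (knit with `T4ShellMeasure.slot_field_of_antiConcentration`) -/

open Literature.MathematicalPhysics.QuantumFieldTheory.Balaban1983to89.T4ShellMeasure (slot_field_of_antiConcentration) in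
/-- **THE `LevelLedger.slot` FIELD FOR A HOMOGENEOUS SLOT STATISTIC.**  With the dictionary binders of
`T4ShellMeasure.slot_field_of_antiConcentration` (pieces `≤ M ×` shell mass of the cut fibre law, `M ×` its total mass
`≤` the term weights — B14 (2.18)'s remaining nonnegative factors) and a finite fibre law, §3 gives the slot inequality of
`T4ShellMeasureLevels.LevelLedger` with the level constant `D_j = 3(d_j + 1)∕(1 − ρ_j)`, `d_j` the block dimension —
polynomial in the block size, hence in ROW T's `…LevelLedgerLinearGrowth.summable_of_pow_mul_geometric` regime.
[textbook] -/
theorem slot_field_of_homogeneous [Nonempty ι] {A : (ι → ℝ) → ℝ} (hA : Measurable A)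
    [IsFiniteMeasure (volume.withDensity fun x : ι → ℝ => ENNReal.ofReal (Real.exp (-A x)))]
    {U : (ι → ℝ) → ℝ} (hUm : Measurable U) (hU : ∀ (c : ℝ), 0 < c → ∀ x, U (c • x) = c * U x)
    {θ ρ : ℝ} (hθ : 0 < θ) (hρ0 : 0 < ρ) (hρ1 : ρ < 1)
    (hmono : ∀ l ∈ Icc (1 - 1 / ((Fintype.card ι : ℝ) + 1)) 1, ∀ x,
      θ * (1 - ρ) ≤ U x → U x < θ → A (l • x) ≤ A x)
    {κ : Type*} (T : Finset κ) {piece Aw : κ → ℝ} {M : ℝ} (hM : 0 ≤ M)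
    (hpiece : ∑ τ ∈ T, piece τ ≤ M *
      (((volume.withDensity fun x : ι → ℝ => ENNReal.ofReal (Real.exp (-A x))).restrict {x | U x < θ})
        {x | θ * (1 - ρ) ≤ U x ∧ U x < θ}).toReal)
    (hAw : M * (((volume.withDensity fun x : ι → ℝ => ENNReal.ofReal (Real.exp (-A x))).restrict {x | U x < θ})
        univ).toReal ≤ ∑ τ ∈ T, Aw τ) :
    ∑ τ ∈ T, piece τ ≤ (3 * ((Fintype.card ι : ℝ) + 1) / (1 - ρ) * ρ) * ∑ τ ∈ T, Aw τ :=
  slot_field_of_antiConcentration (by positivity [show (0:ℝ) < 1 - ρ by linarith]) hρ0.le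
    (slotAntiConcentration_restrict_of_homogeneous hA hUm hU hθ hρ0 hρ1 hmono) T hM hpiece hAw

end Summit.QuantumFields.YangMills.Theorems.N21DilationHazard
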